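import Mathlib.Analysis.Normed.Ring.InfiniteSum
import Mathlib.Analysis.RCLike.Basic
import Mathlib.Topology.Algebra.InfiniteSum.Real
import HarnessLib

/-!
# Finite products of absolutely convergent series over a finite index type

Helper toward the registered stub `stub_tensorisation` of crux AtomicSynthesis ⟨stmt-QuantumFields-28126⟩
(LINE «SlotwiseSynthesis», ym-idea-11 g13): the TENSOR BOOKKEEPING.  For a finite index type `α`, an
arbitrary index type `β` and `f : α → β → R` (`R` a complete normed commutative ring) with every
`∑_i ‖f a i‖ < ∞`, the multi-series `ι ↦ ∏_a f a (ι a)` on `α → β` is absolutely summable and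
`∑'_ι ∏_a f a (ι a) = ∏_a ∑'_i f a i` (`summable_norm_prod_pi_and_tsum`, `hasSum_prod_pi`), with the
`ℓ¹` bound `∑'_ι ‖∏_a f a (ι a)‖ ≤ ∏_a ∑'_i ‖f a i‖` (`tsum_norm_prod_pi_le`) and the non-negative real
form (`summable_prod_pi_of_nonneg`).  Induction on `Fin n` through `Fin.consEquiv` and Mathlib's binary
`tsum_mul_tsum_of_summable_norm` (pattern adapted from the tree's
`Literature.Computability.Cryptography.ChenQuantumLWEStepFour.prod_tsum_int`), then transport along
`Fintype.equivFin`.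

HONEST LABEL: elementary bookkeeping; no crux / rung / summit statement is proved here; the Yang–Mills mass
gap is NOT proved by this file.  Cell `ym-idea-1`, width seat `ym-line-sfw-p2-w3` g37 (free hands).
-/

open Finset

namespace Summit.QuantumFields.YangMills.Theorems.AtomicSynthesisTensor

variable {R : Type*} [NormedCommRing R] [CompleteSpace R]

/-- **Finite products of absolutely convergent series, `Fin n` form**: for `f : Fin n → β → R` with each
`∑_i ‖f l i‖ < ∞`, `ι ↦ ∏_l f l (ι l)` is absolutely summable on `Fin n → β` and
`∑'_ι ∏_l f l (ι l) = ∏_l ∑'_i f l i`. [folklore] -/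
theorem summable_norm_prod_fin_and_tsum {β : Type*} :
    ∀ (n : ℕ) (f : Fin n → β → R), (∀ l, Summable fun i => ‖f l i‖) →
      (Summable fun ι : Fin n → β => ‖∏ l, f l (ι l)‖) ∧
        ∑' ι : Fin n → β, ∏ l, f l (ι l) = ∏ l, ∑' i, f l i := by
  -- adapted from Literature/Computability/Cryptography/ChenQuantumLWEStepFour.lean (`prod_tsum_int`)
  intro n
  induction n with
  | zero =>
    intro f _
    refine ⟨(hasSum_fintype _).summable, ?_⟩
    rw [tsum_fintype]
    simp
  | succ n ih =>
    intro f hf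
    obtain ⟨ihs, iht⟩ := ih (fun l => f l.succ) (fun l => hf l.succ)
    have hsplit : ∀ (a : β) (y : Fin n → β),
        ∏ l : Fin (n + 1), f l (Fin.cons (α := fun _ : Fin (n + 1) => β) a y l) =
          f 0 a * ∏ l : Fin n, f l.succ (y l) := by
      intro a y
      rw [Fin.prod_univ_succ, Fin.cons_zero]
      congr 1
    have hnorm : Summable fun z : β × (Fin n → β) => ‖f 0 z.1 * ∏ l : Fin n, f l.succ (z.2 l)‖ :=
      (hf 0).mul_norm (g := fun y : Fin n → β => ∏ l : Fin n, f l.succ (y l)) ihs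
    have hprod := tsum_mul_tsum_of_summable_norm (f := f 0)
      (g := fun y : Fin n → β => ∏ l : Fin n, f l.succ (y l)) (hf 0) ihs
    refine ⟨?_, ?_⟩
    · rw [← (Fin.consEquiv fun _ : Fin (n + 1) => β).summable_iff]
      refine hnorm.congr fun z => ?_
      simp only [Function.comp_apply, Fin.consEquiv_apply, hsplit]
    · rw [← (Fin.consEquiv fun _ : Fin (n + 1) => β).tsum_eq]
      have e2 : (fun z : β × (Fin n → β) => ∏ l : Fin (n + 1),
          f l ((Fin.consEquiv fun _ : Fin (n + 1) => β) z l)) =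
          fun z => f 0 z.1 * ∏ l : Fin n, f l.succ (z.2 l) := by
        funext z
        simp only [Fin.consEquiv_apply, hsplit]
      rw [e2, ← hprod, iht, Fin.prod_univ_succ]

/-- **Finite products of absolutely convergent series over a finite index type**: for `f : α → β → R`
with each `∑_i ‖f a i‖ < ∞`, `ι ↦ ∏_a f a (ι a)` is absolutely summable on `α → β` and
`∑'_ι ∏_a f a (ι a) = ∏_a ∑'_i f a i`. [folklore] -/
theorem summable_norm_prod_pi_and_tsum {α β : Type*} [Fintype α] (f : α → β → R)
    (hf : ∀ a, Summable fun i => ‖f a i‖) :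
    (Summable fun ι : α → β => ‖∏ a, f a (ι a)‖) ∧
      ∑' ι : α → β, ∏ a, f a (ι a) = ∏ a, ∑' i, f a i := by
  set e : Fin (Fintype.card α) ≃ α := (Fintype.equivFin α).symm with he
  obtain ⟨hs, ht⟩ := summable_norm_prod_fin_and_tsum (Fintype.card α) (fun m => f (e m)) (fun m => hf (e m))
  -- the re-indexing equivalence `(Fin n → β) ≃ (α → β)`, `g ↦ g ∘ e.symm`
  set E : (Fin (Fintype.card α) → β) ≃ (α → β) := Equiv.arrowCongr e (Equiv.refl β) with hE
  have hprod : ∀ g : Fin (Fintype.card α) → β, ∏ a, f a (E g a) = ∏ m, f (e m) (g m) := by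
    intro g
    rw [← e.prod_comp]
    refine Finset.prod_congr rfl fun m _ => ?_
    simp [hE, Equiv.arrowCongr_apply]
  refine ⟨?_, ?_⟩
  · rw [← E.summable_iff]
    exact hs.congr fun g => by simp only [Function.comp_apply, hprod]
  · rw [← E.tsum_eq]
    simp only [hprod]
    rw [ht, ← e.prod_comp]

/-- The multi-series `ι ↦ ∏_a f a (ι a)` is summable. [folklore] -/
theorem summable_prod_pi {α β : Type*} [Fintype α] (f : α → β → R) (hf : ∀ a, Summable fun i => ‖f a i‖) :
    Summable fun ι : α → β => ∏ a, f a (ι a) :=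
  (summable_norm_prod_pi_and_tsum f hf).1.of_norm

/-- **`∑_ι ∏_a f a (ι a) = ∏_a ∑_i f a i`** in `HasSum` form. [folklore] -/
theorem hasSum_prod_pi {α β : Type*} [Fintype α] (f : α → β → R) (hf : ∀ a, Summable fun i => ‖f a i‖) :
    HasSum (fun ι : α → β => ∏ a, f a (ι a)) (∏ a, ∑' i, f a i) := by
  rw [← (summable_norm_prod_pi_and_tsum f hf).2]
  exact (summable_prod_pi f hf).hasSum

/-- **Non-negative real form**: for `0 ≤ v a i` with each `∑_i v a i < ∞`, the multi-series
`ι ↦ ∏_a v a (ι a)` is summable and `∑'_ι ∏_a v a (ι a) = ∏_a ∑'_i v a i`. [folklore] -/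
theorem summable_prod_pi_of_nonneg {α β : Type*} [Fintype α] (v : α → β → ℝ) (hv : ∀ a i, 0 ≤ v a i)
    (hs : ∀ a, Summable (v a)) :
    Summable (fun ι : α → β => ∏ a, v a (ι a)) ∧ ∑' ι : α → β, ∏ a, v a (ι a) = ∏ a, ∑' i, v a i := by
  have hn : ∀ a, Summable fun i => ‖v a i‖ := fun a =>
    (hs a).congr fun i => by rw [Real.norm_eq_abs, abs_of_nonneg (hv a i)]
  exact ⟨summable_prod_pi v hn, (summable_norm_prod_pi_and_tsum v hn).2⟩

/-- **`ℓ¹` bound** (with `‖1‖ = 1`): `∑'_ι ‖∏_a f a (ι a)‖ ≤ ∏_a ∑'_i ‖f a i‖`. [folklore] -/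
theorem tsum_norm_prod_pi_le [NormOneClass R] {α β : Type*} [Fintype α] (f : α → β → R)
    (hf : ∀ a, Summable fun i => ‖f a i‖) :
    ∑' ι : α → β, ‖∏ a, f a (ι a)‖ ≤ ∏ a, ∑' i, ‖f a i‖ := by
  obtain ⟨hs, ht⟩ := summable_prod_pi_of_nonneg (fun a i => ‖f a i‖) (fun _ _ => norm_nonneg _) hf
  rw [← ht]
  exact (summable_norm_prod_pi_and_tsum f hf).1.tsum_le_tsum (fun ι => Finset.norm_prod_le _ _) hs

/-- The `ℓ¹` norms multiply exactly in a normed field (`‖∏‖ = ∏‖·‖`): `∑'_ι ‖∏_a f a (ι a)‖ = ∏_a ∑'_i ‖f a i‖`.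
[folklore] -/
theorem tsum_norm_prod_pi_eq {𝕜 : Type*} [NormedField 𝕜] [CompleteSpace 𝕜] {α β : Type*} [Fintype α]
    (f : α → β → 𝕜) (hf : ∀ a, Summable fun i => ‖f a i‖) :
    ∑' ι : α → β, ‖∏ a, f a (ι a)‖ = ∏ a, ∑' i, ‖f a i‖ := by
  obtain ⟨-, ht⟩ := summable_prod_pi_of_nonneg (fun a i => ‖f a i‖) (fun _ _ => norm_nonneg _) hf
  rw [← ht]
  exact tsum_congr fun ι => norm_prod _ _

end Summit.QuantumFields.YangMills.Theorems.AtomicSynthesisTensor
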